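import Literature.MathematicalPhysics.KineticTheory.TaggedSphereSpectralGap
import Literature.Analysis.FluidPDE.LambertCosineLaw
import Mathlib.Analysis.SpecialFunctions.PolarCoord

/-!
# Isotropy of hard-sphere scattering: the partner law equals the tagged law

Stub `stub_partnerLaw` of the line `Sketch` (swap-symmetrisation / negative type) for the crux
`InformationPercolationEngine.SpectralContractionR` (stmt-AtomisticToContinuum-13913).

For fixed incoming velocities `(v, w)` of `ℝ³`, under the flux weight `((v - w)·ω)₊ dσ(ω)` on `S²`, the
outgoing partner velocity `w' = (collide ω (v, w)).2 = w + ((v-w)·ω) ω` and the outgoing tagged velocity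
`v' = (collide ω (v, w)).1 = v - ((v-w)·ω) ω` have the same law on `ℝ³`.

Proof. Write `q = v - w = n a`, `n = ‖q‖`, `‖a‖ = 1` (if `v = w` both maps are the constant `v`). Then
`v' = w + n (a - ⟪a,ω⟫ ω)`, `w' = w + n ⟪a,ω⟫ ω`, so it suffices (`DiscInv.lintegral_cos_comp_reflect_eq`)
that `∫ ⟪a,ω⟫₊ G(w + n(a - ⟪a,ω⟫ω)) dσ(ω) = ∫ ⟪a,ω⟫₊ G(w + n ⟪a,ω⟫ ω) dσ(ω)` for measurable `G ≥ 0`.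
Archimedes' hat-box theorem in flux form (`Literature.Analysis.FluidPDE.lintegral_toSphere_cos_comp_coords`,
with `Lambert.lift_coords`) turns both sides into integrals over the unit disc of `ℝ²` of
`G(w + n(a - ⟪a,ν⟫ν))`, resp. `G(w + n ⟪a,ν⟫ν)`, `ν = lift a p` (`DiscInv.lintegral_cos_mul_eq_ball`). The disc
involution `β p = -√(1 - ‖p‖²) p/‖p‖` satisfies `a - ⟪a,ν⟫ν = ⟪a,ν'⟫ν'` for `ν' = lift a (β p)`
(`DiscInv.sub_inner_smul_lift_eq`), and **`β` preserves Lebesgue measure on the unit disc**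
(`DiscInv.setLIntegral_ball_comp_discInv`): negation does, and in polar coordinates
(`lintegral_comp_polarCoord_symm`) `-β` reads `(r, θ) ↦ (√(1 - r²), θ)`, which preserves `r dr dθ` on
`(0,1) × (-π,π)` by the radial identity `∫₀¹ r H(√(1-r²)) dr = ∫₀¹ r H(r) dr` (both are `½ ∫₀¹ H(√u) du`:
substitutions `u = 1 - r²`, `u = r²`, `lintegral_image_eq_lintegral_abs_deriv_mul`).
-/

noncomputable section
open MeasureTheory Metric Real Set Filter Topology
open scoped InnerProductSpace ENNReal
namespace Summit.AtomisticToContinuum.HydrodynamicLimit.Theorems.SpectralContractionRLine.PartnerLaw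
open Literature.MathematicalPhysics.KineticTheory
open Literature.Analysis.FunctionSpaces (maxwellianBeta maxwellianBeta_one maxwellianBeta_pos)
open TaggedSphereDiffusion (collisionFrequency)

/-! ## The disc involution `β p = -√(1 - ‖p‖²) p / ‖p‖` preserves Lebesgue measure on the unit disc -/

namespace DiscInv

open Literature.Analysis.FluidPDE

/-! ### The radial identity `∫₀¹ r H(√(1 - r²)) dr = ∫₀¹ r H(r) dr` -/

/-- The substitution `u = r²` on `(0, 1)`: `∫₀¹ H(√u) du = ∫₀¹ 2r H(r) dr`. [folklore] -/
theorem lintegral_comp_sqrt_eq (H : ℝ → ℝ≥0∞) :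
    ∫⁻ u in Ioo (0 : ℝ) 1, H (√u) = ∫⁻ r in Ioo (0 : ℝ) 1, ENNReal.ofReal (2 * r) * H r := by
  have hderiv : ∀ x ∈ Ioo (0 : ℝ) 1, HasDerivWithinAt (fun r : ℝ => r ^ 2) (2 * x) (Ioo 0 1) x := by
    intro x _
    have h := hasDerivAt_pow 2 x
    simp only [Nat.cast_ofNat, Nat.add_one_sub_one, pow_one] at h
    exact h.hasDerivWithinAt
  have hinj : InjOn (fun r : ℝ => r ^ 2) (Ioo 0 1) := fun a ha b hb hab =>
    (pow_left_inj₀ ha.1.le hb.1.le two_ne_zero).1 hab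
  have himg : (fun r : ℝ => r ^ 2) '' Ioo 0 1 = Ioo 0 1 := by
    ext u
    constructor
    · rintro ⟨r, hr, rfl⟩
      exact ⟨pow_pos hr.1 2, pow_lt_one₀ hr.1.le hr.2 two_ne_zero⟩
    · intro hu
      exact ⟨√u, ⟨Real.sqrt_pos.2 hu.1, (Real.sqrt_lt' one_pos).2 (by linarith [hu.2])⟩,
        Real.sq_sqrt hu.1.le⟩
  have h := lintegral_image_eq_lintegral_abs_deriv_mul measurableSet_Ioo hderiv hinj (fun u => H (√u))
  rw [himg] at h
  rw [h]
  refine setLIntegral_congr_fun measurableSet_Ioo (fun r hr => ?_)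
  rw [abs_of_pos (by linarith [hr.1]), Real.sqrt_sq hr.1.le]

/-- The substitution `u = 1 - r²` on `(0, 1)`: `∫₀¹ H(√u) du = ∫₀¹ 2r H(√(1 - r²)) dr`. [folklore] -/
theorem lintegral_comp_sqrt_eq' (H : ℝ → ℝ≥0∞) :
    ∫⁻ u in Ioo (0 : ℝ) 1, H (√u) =
      ∫⁻ r in Ioo (0 : ℝ) 1, ENNReal.ofReal (2 * r) * H (√(1 - r ^ 2)) := by
  have hderiv : ∀ x ∈ Ioo (0 : ℝ) 1,
      HasDerivWithinAt (fun r : ℝ => 1 - r ^ 2) (-(2 * x)) (Ioo 0 1) x := by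
    intro x _
    have h := (hasDerivAt_pow 2 x).const_sub 1
    simp only [Nat.cast_ofNat, Nat.add_one_sub_one, pow_one] at h
    exact h.hasDerivWithinAt
  have hinj : InjOn (fun r : ℝ => 1 - r ^ 2) (Ioo 0 1) := by
    intro a ha b hb hab
    have hab' : a ^ 2 = b ^ 2 := by simp only at hab; linarith
    exact (pow_left_inj₀ ha.1.le hb.1.le two_ne_zero).1 hab'
  have himg : (fun r : ℝ => 1 - r ^ 2) '' Ioo 0 1 = Ioo 0 1 := by
    ext u
    constructor
    · rintro ⟨r, hr, rfl⟩
      have h1 : r ^ 2 < 1 := pow_lt_one₀ hr.1.le hr.2 two_ne_zero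
      have h2 : 0 < r ^ 2 := pow_pos hr.1 2
      exact ⟨by linarith, by linarith⟩
    · intro hu
      have h1u : 0 < 1 - u := by linarith [hu.2]
      refine ⟨√(1 - u), ⟨Real.sqrt_pos.2 h1u, (Real.sqrt_lt' one_pos).2 (by linarith [hu.1])⟩, ?_⟩
      simp only
      rw [Real.sq_sqrt h1u.le]
      ring
  have h := lintegral_image_eq_lintegral_abs_deriv_mul measurableSet_Ioo hderiv hinj (fun u => H (√u))
  rw [himg] at h
  rw [h]
  refine setLIntegral_congr_fun measurableSet_Ioo (fun r hr => ?_)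
  rw [abs_neg, abs_of_pos (by linarith [hr.1])]

/-- **The radial identity**: `∫₀¹ r H(√(1 - r²)) dr = ∫₀¹ r H(r) dr` (both are `½ ∫₀¹ H(√u) du`).
[folklore] -/
theorem lintegral_mul_comp_sqrt_one_sub_sq (H : ℝ → ℝ≥0∞) :
    ∫⁻ r in Ioo (0 : ℝ) 1, ENNReal.ofReal r * H (√(1 - r ^ 2)) =
      ∫⁻ r in Ioo (0 : ℝ) 1, ENNReal.ofReal r * H r := by
  have h := (lintegral_comp_sqrt_eq' H).symm.trans (lintegral_comp_sqrt_eq H)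
  have h2 : ∀ r : ℝ, ENNReal.ofReal (2 * r) = 2 * ENNReal.ofReal r := fun r => by
    rw [ENNReal.ofReal_mul zero_le_two, ENNReal.ofReal_ofNat]
  simp_rw [h2, mul_assoc] at h
  rw [lintegral_const_mul' _ _ ENNReal.ofNat_ne_top, lintegral_const_mul' _ _ ENNReal.ofNat_ne_top] at h
  exact (ENNReal.mul_right_inj two_ne_zero ENNReal.ofNat_ne_top).1 h

/-- **The polar-rectangle form of the disc involution**: `(r, θ) ↦ (√(1 - r²), θ)` preserves the measure
`r dr dθ` on `(0, 1) × (-π, π)` (Tonelli, then the radial identity at fixed `θ`). [folklore] -/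
theorem lintegral_polarRect_comp (K : ℝ × ℝ → ℝ≥0∞) (hK : Measurable K) :
    ∫⁻ q in Ioo (0 : ℝ) 1 ×ˢ Ioo (-π) π, ENNReal.ofReal q.1 * K (√(1 - q.1 ^ 2), q.2) =
      ∫⁻ q in Ioo (0 : ℝ) 1 ×ˢ Ioo (-π) π, ENNReal.ofReal q.1 * K q := by
  have hm1 : Measurable fun q : ℝ × ℝ => ENNReal.ofReal q.1 * K (√(1 - q.1 ^ 2), q.2) :=
    (ENNReal.measurable_ofReal.comp measurable_fst).mul
      (hK.comp ((((measurable_fst.pow_const 2).const_sub 1).sqrt).prodMk measurable_snd))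
  have hm2 : Measurable fun q : ℝ × ℝ => ENNReal.ofReal q.1 * K q :=
    (ENNReal.measurable_ofReal.comp measurable_fst).mul hK
  rw [Measure.volume_eq_prod, ← Measure.prod_restrict, lintegral_prod_symm _ hm1.aemeasurable,
    lintegral_prod_symm _ hm2.aemeasurable]
  exact lintegral_congr fun θ => lintegral_mul_comp_sqrt_one_sub_sq (fun u => K (u, θ))

/-! ### Polar coordinates on the unit disc of `ℝ² = EuclideanSpace ℝ (Fin 2)` -/

/-- The polar point `(r cos θ, r sin θ)` of `ℝ²` has norm `r` (`r ≥ 0`). [folklore] -/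
theorem norm_polar_toLp {r : ℝ} (hr : 0 ≤ r) (θ : ℝ) :
    ‖(WithLp.toLp 2 ![r * cos θ, r * sin θ] : EuclideanSpace ℝ (Fin 2))‖ = r := by
  have h : ‖(WithLp.toLp 2 ![r * cos θ, r * sin θ] : EuclideanSpace ℝ (Fin 2))‖ ^ 2 = r ^ 2 := by
    rw [EuclideanSpace.real_norm_sq_eq, Fin.sum_univ_two]
    show (r * cos θ) ^ 2 + (r * sin θ) ^ 2 = r ^ 2
    nlinarith [Real.cos_sq_add_sin_sq θ]
  exact (pow_left_inj₀ (norm_nonneg _) hr two_ne_zero).1 h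

/-- Scalars act coordinatewise on `ℝ²`. [folklore] -/
theorem smul_toLp_two (c x y : ℝ) :
    c • (WithLp.toLp 2 ![x, y] : EuclideanSpace ℝ (Fin 2)) = WithLp.toLp 2 ![c * x, c * y] := by
  ext i
  fin_cases i <;> simp

/-- **Polar coordinates on the unit disc of `ℝ²`**:
`∫_{‖p‖<1} H = ∫_{(0,1)×(-π,π)} r H(r cos θ, r sin θ) dr dθ`. [folklore] -/
theorem setLIntegral_ball_eq_polar (H : EuclideanSpace ℝ (Fin 2) → ℝ≥0∞) :
    ∫⁻ p in ball 0 1, H p = ∫⁻ q in Ioo (0 : ℝ) 1 ×ˢ Ioo (-π) π,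
      ENNReal.ofReal q.1 * H (WithLp.toLp 2 ![q.1 * cos q.2, q.1 * sin q.2]) := by
  set T : EuclideanSpace ℝ (Fin 2) ≃ᵐ ℝ × ℝ :=
    (MeasurableEquiv.toLp 2 (Fin 2 → ℝ)).symm.trans MeasurableEquiv.finTwoArrow
  have hTmp : MeasurePreserving T.symm volume volume :=
    ((EuclideanSpace.volume_preserving_symm_measurableEquiv_toLp (Fin 2)).trans
      (volume_preserving_finTwoArrow ℝ)).symm
  have hTs : ∀ q, T.symm (polarCoord.symm q) = WithLp.toLp 2 ![q.1 * cos q.2, q.1 * sin q.2] :=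
    fun q => by rw [polarCoord_symm_apply]; rfl
  have hrect : MeasurableSet (Iio (1 : ℝ) ×ˢ (univ : Set ℝ)) := measurableSet_Iio.prod MeasurableSet.univ
  rw [← lintegral_indicator measurableSet_ball, ← hTmp.lintegral_comp_emb T.symm.measurableEmbedding,
    ← lintegral_comp_polarCoord_symm, polarCoord_target,
    show Ioo (0 : ℝ) 1 ×ˢ Ioo (-π) π = Iio (1 : ℝ) ×ˢ (univ : Set ℝ) ∩ Ioi (0 : ℝ) ×ˢ Ioo (-π) π by
      rw [prod_inter_prod, Iio_inter_Ioi, univ_inter],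
    ← Measure.restrict_restrict hrect, ← lintegral_indicator hrect]
  refine setLIntegral_congr_fun (measurableSet_Ioi.prod measurableSet_Ioo) (fun q hq => ?_)
  have hr : 0 < q.1 := hq.1
  have hnorm := norm_polar_toLp hr.le q.2
  simp only [smul_eq_mul, hTs]
  by_cases h1 : q.1 < 1
  · rw [indicator_of_mem (show q ∈ Iio (1 : ℝ) ×ˢ (univ : Set ℝ) from ⟨h1, trivial⟩),
      indicator_of_mem (by rw [mem_ball_zero_iff, hnorm]; exact h1)]
  · rw [indicator_of_notMem (show q ∉ Iio (1 : ℝ) ×ˢ (univ : Set ℝ) from fun h => h1 h.1),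
      indicator_of_notMem (by rw [mem_ball_zero_iff, hnorm]; exact h1), mul_zero]

/-! ### The involution -/

/-- Negation preserves Lebesgue measure on the unit disc. [folklore] -/
theorem setLIntegral_ball_comp_neg (F : EuclideanSpace ℝ (Fin 2) → ℝ≥0∞) (hF : Measurable F) :
    ∫⁻ p in ball 0 1, F (-p) = ∫⁻ p in ball 0 1, F p := by
  have h := (Measure.measurePreserving_neg (volume : Measure (EuclideanSpace ℝ (Fin 2))))
    |>.setLIntegral_comp_preimage (s := ball 0 1) measurableSet_ball hF
  rwa [show Neg.neg ⁻¹' ball (0 : EuclideanSpace ℝ (Fin 2)) 1 = ball 0 1 by ext p; simp] at h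

/-- **The disc involution `β p = -√(1 - ‖p‖²) p/‖p‖` preserves Lebesgue measure on the unit disc**:
negation does, and `-β` reads `(r, θ) ↦ (√(1 - r²), θ)` in polar coordinates (`lintegral_polarRect_comp`).
[folklore] -/
theorem setLIntegral_ball_comp_discInv (F : EuclideanSpace ℝ (Fin 2) → ℝ≥0∞) (hF : Measurable F) :
    ∫⁻ p in ball 0 1, F (-((√(1 - ‖p‖ ^ 2) / ‖p‖) • p)) = ∫⁻ p in ball 0 1, F p := by
  rw [← setLIntegral_ball_comp_neg F hF,
    setLIntegral_ball_eq_polar (fun p => F (-((√(1 - ‖p‖ ^ 2) / ‖p‖) • p))),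
    setLIntegral_ball_eq_polar (fun p => F (-p))]
  set T : EuclideanSpace ℝ (Fin 2) ≃ᵐ ℝ × ℝ :=
    (MeasurableEquiv.toLp 2 (Fin 2 → ℝ)).symm.trans MeasurableEquiv.finTwoArrow
  have hTs : ∀ q, T.symm (polarCoord.symm q) = WithLp.toLp 2 ![q.1 * cos q.2, q.1 * sin q.2] :=
    fun q => by rw [polarCoord_symm_apply]; rfl
  have hK : Measurable fun q : ℝ × ℝ =>
      F (-(WithLp.toLp 2 ![q.1 * cos q.2, q.1 * sin q.2] : EuclideanSpace ℝ (Fin 2))) := by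
    simp_rw [← hTs]
    exact hF.comp ((T.symm.measurable.comp continuous_polarCoord_symm.measurable).neg)
  rw [← lintegral_polarRect_comp _ hK]
  refine setLIntegral_congr_fun (measurableSet_Ioo.prod measurableSet_Ioo) (fun q hq => ?_)
  have hr : 0 < q.1 := hq.1.1
  have e1 : √(1 - q.1 ^ 2) / q.1 * (q.1 * cos q.2) = √(1 - q.1 ^ 2) * cos q.2 := by field_simp
  have e2 : √(1 - q.1 ^ 2) / q.1 * (q.1 * sin q.2) = √(1 - q.1 ^ 2) * sin q.2 := by field_simp
  simp only
  rw [norm_polar_toLp hr.le, smul_toLp_two, e1, e2]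

/-! ### Geometry: `β` flips the reflected axis -/

/-- `‖β p‖ = √(1 - ‖p‖²)` (`p ≠ 0`). [folklore] -/
theorem norm_discInv {p : EuclideanSpace ℝ (Fin 2)} (hp : p ≠ 0) :
    ‖-((√(1 - ‖p‖ ^ 2) / ‖p‖) • p)‖ = √(1 - ‖p‖ ^ 2) := by
  rw [norm_neg, norm_smul, Real.norm_eq_abs,
    abs_of_nonneg (div_nonneg (Real.sqrt_nonneg _) (norm_nonneg _)),
    div_mul_cancel₀ _ (norm_ne_zero_iff.2 hp)]

/-- `√(1 - ‖β p‖²) = ‖p‖` on the punctured closed unit disc. [folklore] -/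
theorem sqrt_one_sub_norm_discInv_sq {p : EuclideanSpace ℝ (Fin 2)} (hp : p ≠ 0) (hp1 : ‖p‖ ≤ 1) :
    √(1 - ‖-((√(1 - ‖p‖ ^ 2) / ‖p‖) • p)‖ ^ 2) = ‖p‖ := by
  rw [norm_discInv hp, Real.sq_sqrt (by nlinarith [norm_nonneg p]), sub_sub_cancel,
    Real.sqrt_sq (norm_nonneg _)]

/-- The lift of `β p`: `lift a (β p) = -(√(1 - ‖p‖²)/‖p‖) embed a p + ‖p‖ a`. [folklore] -/
theorem lift_discInv (a : V3) {p : EuclideanSpace ℝ (Fin 2)} (hp : p ≠ 0) (hp1 : ‖p‖ ≤ 1) :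
    Lambert.lift a (-((√(1 - ‖p‖ ^ 2) / ‖p‖) • p)) =
      (-(√(1 - ‖p‖ ^ 2) / ‖p‖)) • Lambert.embed a p + ‖p‖ • a := by
  rw [Lambert.lift, sqrt_one_sub_norm_discInv_sq hp hp1, ← neg_smul, Lambert.embed_smul]

/-- **The disc involution flips the reflected axis**: with `ν = lift a p`, `ν' = lift a (β p)` (unit `a`,
`0 < ‖p‖ ≤ 1`), `a - ⟪a, ν⟫ ν = ⟪a, ν'⟫ ν'`; equivalently `R_{ν'} a = -R_ν a` for the reflection
`R_ν a = a - 2⟪a, ν⟫ ν`. [folklore] -/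
theorem sub_inner_smul_lift_eq {a : V3} (ha : ‖a‖ = 1) {p : EuclideanSpace ℝ (Fin 2)} (hp : p ≠ 0)
    (hp1 : ‖p‖ ≤ 1) :
    a - ⟪a, Lambert.lift a p⟫_ℝ • Lambert.lift a p =
      ⟪a, Lambert.lift a (-((√(1 - ‖p‖ ^ 2) / ‖p‖) • p))⟫_ℝ •
        Lambert.lift a (-((√(1 - ‖p‖ ^ 2) / ‖p‖) • p)) := by
  have h1 : ⟪a, Lambert.lift a p⟫_ℝ = √(1 - ‖p‖ ^ 2) := by
    rw [real_inner_comm, Lambert.inner_lift_self ha]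
  have h2 : ⟪a, Lambert.lift a (-((√(1 - ‖p‖ ^ 2) / ‖p‖) • p))⟫_ℝ = ‖p‖ := by
    rw [real_inner_comm, Lambert.inner_lift_self ha, sqrt_one_sub_norm_discInv_sq hp hp1]
  rw [h1, h2, lift_discInv a hp hp1, Lambert.lift]
  have hs2 : √(1 - ‖p‖ ^ 2) * √(1 - ‖p‖ ^ 2) = 1 - ‖p‖ * ‖p‖ := by
    rw [← pow_two, Real.sq_sqrt (by nlinarith [norm_nonneg p]), pow_two]
  have hsn : ‖p‖ * (-(√(1 - ‖p‖ ^ 2) / ‖p‖)) = -√(1 - ‖p‖ ^ 2) := by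
    have hn : ‖p‖ ≠ 0 := norm_ne_zero_iff.2 hp
    field_simp
  simp only [smul_add, smul_smul]
  rw [hs2, hsn]
  module

/-! ### Isotropy on the sphere -/

/-- **The cosine law is the lifted disc law** (hat-box theorem, `lintegral_toSphere_cos_comp_coords` with
`Lambert.lift_coords`): `∫ ⟪a,ω⟫₊ g(ω) dσ(ω) = ∫_{‖p‖<1} g(lift a p) dp` for measurable `g ≥ 0` on `ℝ³`.
[folklore] -/
theorem lintegral_cos_mul_eq_ball {a : V3} (ha : ‖a‖ = 1) {g : V3 → ℝ≥0∞} (hg : Measurable g) :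
    ∫⁻ ω : sphere (0 : V3) 1, ENNReal.ofReal ⟪a, (ω : V3)⟫_ℝ * g ω ∂(volume.toSphere) =
      ∫⁻ p in ball (0 : EuclideanSpace ℝ (Fin 2)) 1, g (Lambert.lift a p) := by
  rw [← lintegral_toSphere_cos_comp_coords ha (f := fun p => g (Lambert.lift a p))
    (hg.comp (Lambert.measurable_lift a))]
  refine lintegral_congr (fun ω => ?_)
  have hω : ‖(ω : V3)‖ = 1 := by simp
  rcases le_or_gt ⟪a, (ω : V3)⟫_ℝ 0 with h0 | h0
  · rw [ENNReal.ofReal_of_nonpos h0, zero_mul, zero_mul]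
  · simp only [Lambert.lift_coords ha hω h0.le]

/-- **Antipodal symmetry of the reflected axis under the cosine law**: for a unit vector `a`, measurable
`G ≥ 0` on `ℝ³`, `w ∈ ℝ³` and `n ∈ ℝ`,
`∫ ⟪a,ω⟫₊ G(w + n (a - ⟪a,ω⟫ ω)) dσ(ω) = ∫ ⟪a,ω⟫₊ G(w + n ⟪a,ω⟫ ω) dσ(ω)`.
Both sides are integrals over the unit disc (`lintegral_cos_mul_eq_ball`), exchanged off the null centre by
the measure-preserving disc involution `β` (`sub_inner_smul_lift_eq`, `setLIntegral_ball_comp_discInv`).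
[folklore] -/
theorem lintegral_cos_comp_reflect_eq {a : V3} (ha : ‖a‖ = 1) (w : V3) (n : ℝ) {G : V3 → ℝ≥0∞}
    (hG : Measurable G) :
    ∫⁻ ω : sphere (0 : V3) 1, ENNReal.ofReal ⟪a, (ω : V3)⟫_ℝ *
        G (w + n • (a - ⟪a, (ω : V3)⟫_ℝ • (ω : V3))) ∂(volume.toSphere) =
      ∫⁻ ω : sphere (0 : V3) 1, ENNReal.ofReal ⟪a, (ω : V3)⟫_ℝ *
        G (w + n • (⟪a, (ω : V3)⟫_ℝ • (ω : V3))) ∂(volume.toSphere) := by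
  have hc := Lambert.continuous_lift a
  have hm₁ : Measurable fun x : V3 => G (w + n • (a - ⟪a, x⟫_ℝ • x)) := hG.comp (by fun_prop)
  have hm₂ : Measurable fun x : V3 => G (w + n • (⟪a, x⟫_ℝ • x)) := hG.comp (by fun_prop)
  have hm₃ : Measurable fun p : EuclideanSpace ℝ (Fin 2) =>
      G (w + n • (⟪a, Lambert.lift a p⟫_ℝ • Lambert.lift a p)) := hG.comp (by fun_prop)
  rw [lintegral_cos_mul_eq_ball ha hm₁, lintegral_cos_mul_eq_ball ha hm₂,
    ← setLIntegral_ball_comp_discInv _ hm₃]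
  refine setLIntegral_congr_fun_ae measurableSet_ball ?_
  have hae : ∀ᵐ p : EuclideanSpace ℝ (Fin 2) ∂volume, p ∈ ({0} : Set (EuclideanSpace ℝ (Fin 2)))ᶜ :=
    compl_mem_ae_iff.2 (measure_singleton 0)
  filter_upwards [hae] with p hp0 hp1
  rw [mem_ball_zero_iff] at hp1
  rw [sub_inner_smul_lift_eq ha hp0 hp1.le]

end DiscInv

/-! ## The partner law -/

/-- Integration against the push-forward of a weighted measure. [folklore] -/
theorem lintegral_map_withDensity {α β : Type*} [MeasurableSpace α] [MeasurableSpace β] (μ : Measure α)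
    {d : α → ℝ≥0∞} (hd : Measurable d) {Φ : α → β} (hΦ : Measurable Φ) {G : β → ℝ≥0∞}
    (hG : Measurable G) :
    ∫⁻ x, G x ∂((μ.withDensity d).map Φ) = ∫⁻ ω, d ω * G (Φ ω) ∂μ := by
  rw [lintegral_map hG hΦ]
  change ∫⁻ x, (G ∘ Φ) x ∂_ = _
  rw [lintegral_withDensity_eq_lintegral_mul _ hd (hG.comp hΦ)]
  rfl

/-- **STUB A — isotropy of hard-sphere scattering: the partner law equals the tagged law.**
For fixed incoming velocities `(v, w)`, under the flux weight `((v-w)·ω)₊ dσ(ω)` the outgoing partner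
velocity `w' = (collide ω (v,w)).2` and the outgoing tagged velocity `v' = (collide ω (v,w)).1` have the
SAME law on `ℝ³`. With `q = v - w = n a` (`n = ‖q‖`, `‖a‖ = 1`; for `v = w` both maps are the constant
`v`), `v' = w + n (a - ⟪a,ω⟫ω)` and `w' = w + n ⟪a,ω⟫ ω`, and the lower integrals of every measurable `G ≥ 0`
against the two push-forwards agree by `DiscInv.lintegral_cos_comp_reflect_eq`: Archimedes' hat-box theorem
in flux form (`Literature.Analysis.FluidPDE.lintegral_toSphere_cos_comp_coords`) moves both to the unit disc of
`ℝ²`, where the Lebesgue-measure-preserving involution `β p = -√(1-‖p‖²) p/‖p‖`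
(`DiscInv.setLIntegral_ball_comp_discInv`: polar coordinates and the substitution `u = r²`) exchanges them
(`DiscInv.sub_inner_smul_lift_eq`). [folklore] -/
theorem stub_partnerLaw : ∀ v w : V3,
    (sphereMeasure.withDensity (fun ω => ENNReal.ofReal (hardSphereKernel (v, w) ω))).map
        (fun ω => (collide ω (v, w)).2) =
      (sphereMeasure.withDensity (fun ω => ENNReal.ofReal (hardSphereKernel (v, w) ω))).map
        (fun ω => (collide ω (v, w)).1) := by
  intro v w
  by_cases hvw : v = w
  · subst hvw
    rw [show (fun ω : sphere (0 : V3) 1 => (collide ω (v, v)).2) = fun ω => (collide ω (v, v)).1 by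
      funext ω; simp [collide]]
  -- `q = v - w = n • a` with `n = ‖q‖ > 0`, `‖a‖ = 1`
  set q : V3 := v - w with hq
  have hq0 : q ≠ 0 := sub_ne_zero.2 hvw
  set n : ℝ := ‖q‖ with hn
  have hn0 : 0 < n := norm_pos_iff.2 hq0
  set a : V3 := n⁻¹ • q with ha
  have ha1 : ‖a‖ = 1 := by rw [ha, hn]; exact norm_smul_inv_norm hq0
  have hqa : q = n • a := by rw [ha, smul_smul, mul_inv_cancel₀ hn0.ne', one_smul]
  have hv : v = w + n • a := by rw [← hqa, hq]; abel
  clear_value a n q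
  have hinner : ∀ ω : sphere (0 : V3) 1, ⟪v - w, (ω : V3)⟫_ℝ = n * ⟪a, (ω : V3)⟫_ℝ := fun ω => by
    rw [← hq, hqa, real_inner_smul_left]
  -- measurability of the density and of the two outgoing velocities
  have hdens : Measurable fun ω : sphere (0 : V3) 1 => ENNReal.ofReal (hardSphereKernel (v, w) ω) := by
    unfold hardSphereKernel
    refine ENNReal.measurable_ofReal.comp ?_
    exact ((continuous_const.inner continuous_subtype_val).max continuous_const).measurable
  have hΦ₁ : Measurable fun ω : sphere (0 : V3) 1 => (collide ω (v, w)).1 := by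
    refine Continuous.measurable ?_
    simp only [collide]
    fun_prop
  have hΦ₂ : Measurable fun ω : sphere (0 : V3) 1 => (collide ω (v, w)).2 := by
    refine Continuous.measurable ?_
    simp only [collide]
    fun_prop
  have hmax : ∀ x : ℝ, ENNReal.ofReal (max x 0) = ENNReal.ofReal x := fun x => by
    rw [ENNReal.ofReal_max, ENNReal.ofReal_zero, max_zero]
  -- test both push-forwards against a measurable `G ≥ 0`
  refine Measure.ext_of_lintegral _ (fun G hG => ?_)
  rw [lintegral_map_withDensity _ hdens hΦ₂ hG, lintegral_map_withDensity _ hdens hΦ₁ hG]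
  simp only [collide, hardSphereKernel, hmax, hinner]
  have h1 : ∀ ω : sphere (0 : V3) 1, v - (n * ⟪a, (ω : V3)⟫_ℝ) • (ω : V3) =
      w + n • (a - ⟪a, (ω : V3)⟫_ℝ • (ω : V3)) := fun ω => by
    rw [hv, smul_sub, smul_smul]
    abel
  have h2 : ∀ ω : sphere (0 : V3) 1,
      (n * ⟪a, (ω : V3)⟫_ℝ) • (ω : V3) = n • (⟪a, (ω : V3)⟫_ℝ • (ω : V3)) := fun ω => by
    rw [smul_smul]
  have h3 : ∀ ω : sphere (0 : V3) 1, ENNReal.ofReal (n * ⟪a, (ω : V3)⟫_ℝ) =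
      ENNReal.ofReal n * ENNReal.ofReal ⟪a, (ω : V3)⟫_ℝ := fun ω => ENNReal.ofReal_mul hn0.le
  simp_rw [h1, h2, h3, mul_assoc]
  rw [lintegral_const_mul' _ _ ENNReal.ofReal_ne_top, lintegral_const_mul' _ _ ENNReal.ofReal_ne_top]
  congr 1
  exact (DiscInv.lintegral_cos_comp_reflect_eq ha1 w n hG).symm

end Summit.AtomisticToContinuum.HydrodynamicLimit.Theorems.SpectralContractionRLine.PartnerLaw

end
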